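import Summits.CriticalPhenomena.PercolationContinuityZ3.Theorems.SahiMasterFamilyPointwisePrincipalCapFour
import Summits.CriticalPhenomena.PercolationContinuityZ3.Theorems.SahiMasterFamilyPointwiseFaceVanishing
import Summits.CriticalPhenomena.PercolationContinuityZ3.Theorems.SahiMasterFamilyPrincipalCapC5

/-!
# Face-vanishing families are principal-cap at every order `≥ 4` (no side conditions); pointwise (EQ-4) and Sahi's `C₄`, `C₅`
# on EVERY face-vanishing family of orders four and five

Unit `prim-master-conj` (crux anchor stmt-CriticalPhenomena-4575, helper work), gen 13.  A family of increasing events determined by `S` is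
FACE-VANISHING if all its one-coordinate minors at coordinates of `S` are zero flags.

1. **(FVT_k) without side conditions** (`GluedFrames.principalCap_of_faceVanishing`, every order `k = n + 4 ≥ 4`): a face-vanishing
   family of non-empty, non-sure increasing events with no `Z_{k−1}` deletion and no member containing all the others is PRINCIPAL-CAP
   (`⋂_j U_j = {T | c ⊆ T}`).  This is gen 12's `terminalTightAt_univ_of_localToGlobal` + `localToGlobal_all` + the `pull` transport of
   `terminalTightAt_of_pull`, re-run verbatim after observing that the two "terminal" side conditions of (TT_k) — no common pivotal
   coordinate, no private coordinate — are never used in those proofs.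
2. **Order four, pointwise** (`Pointwise.sahiE_four_ind_eq_zero_iff_of_faceVanishing`): for EVERY face-vanishing quadruple and every
   interior `p`, `E₄(μ_p; 1_U) = 0 ↔ U ∈ Z₄`.  Cases: an empty member (both sides hold); a `Z₃` deletion (`masterFamily_step_all`); an
   absorbing member `U_j ⊇ U_l` (factor `E₄ = (3 − μU_j)·E₃(U_{−j})`, `sahiE_ind_eq_of_absorbing`; the deleted triple is face-vanishing —
   its minors are the deleted minors, zero flags by the same factorisation and (EQI-3) — so gen 13's pointwise (EQ-3) on face-vanishing
   triples applies, and `U ∈ Z₄ ↔ U_{−j} ∈ Z₃`); otherwise principal-cap by 1 and comb-positive by `combPos_sahiE_four_of_principalCap`.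
   Strict form `sahiE_four_ind_pos_of_faceVanishing`; law level `sahiE_four_ind_nonneg_of_faceVanishing` (**Sahi's `C₄` on every
   face-vanishing quadruple**, every `p ∈ [0,1]^ι`).
3. **Order five, law level** (`sahiE_five_ind_nonneg_of_faceVanishing`): **Sahi's `C₅` on every face-vanishing 5-family** — the same case
   analysis with seat P4's `PrincipalCapC3.sahiE_five_ind_nonneg_of_principalCap` at the end and item 2's `C₄` in the absorbing case.
   (Pointwise (EQ-5) there would need the order-five certificate at the comb level; not done.)
HONEST FRAMING: (EQ-k), `C_k`, Kahn's Conjecture 5 in general remain OPEN.  Axioms standard. [this work]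
-/

noncomputable section

open scoped Classical

namespace Summit.CriticalPhenomena.PercolationContinuityZ3.Theorems

open Finset Function
open Literature.Combinatorics.Sahi2008
open Literature.Probability.LatticeModels.Kahn2022 (Affects)
open Literature.Probability.Percolation (DeterminedBy determinedBy_iff)
open Literature.Probability.Percolation.DecisionTree (ind)

namespace GluedFrames

/-! ### 1. Face-vanishing families are principal-cap (every order `≥ 4`) -/

/-- **(FVT) on the full coordinate set**: `n + 4` increasing, non-empty, non-sure events of `2^ι` with no `Z_{n+3}` deletion, all minors
zero flags and no member containing all the others have a principal common part.  (Gen 12's `terminalTightAt_univ_of_localToGlobal`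
without the two unused terminal side conditions.) [this work] -/
theorem principalCap_of_faceVanishing_univ (n : ℕ) (ι : Type) [Fintype ι] (U : Fin (n + 1 + 3) → Set (Set ι))
    (hU : ∀ j, IsUpperSet (U j)) (hne : ∀ j, (U j).Nonempty) (h0 : ∀ j, (∅ : Set ι) ∉ U j)
    (hno : ∀ m : Fin (n + 1 + 3), ¬ SuppZeroFlag (n + 1 + 2) (fun j => U (m.succAbove j)))
    (hall : ∀ e : ι, ∀ b : Bool, SuppZeroFlag (n + 1 + 3) (fun j => secAt e b (U j)))
    (habs : ∀ j, ∃ l, l ≠ j ∧ ¬ U l ⊆ U j) :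
    ∃ c : Finset ι, ∀ T : Set ι, (∀ j, T ∈ U j) ↔ (↑c : Set ι) ⊆ T := by
  by_contra hcap
  -- a core-free coordinate exists (else the cap is `{univ}`, principal)
  have hE0 : ∃ f, CoreFree U f := by
    by_contra hnone
    push Not at hnone
    refine hcap ⟨univ, fun T => ⟨fun hT => ?_, fun hT j => ?_⟩⟩
    · rw [coe_univ, Set.univ_subset_iff]
      by_contra hTu
      obtain ⟨f, hf⟩ := (Set.ne_univ_iff_exists_notMem T).1 hTu
      obtain ⟨k, hk⟩ : ∃ k, Set.univ \ {f} ∉ U k := by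
        have := hnone f; unfold CoreFree at this; push Not at this; exact this
      exact hk (hU k (fun x hx => ⟨Set.mem_univ x, fun hxf => hf (hxf ▸ hx)⟩ : T ⊆ Set.univ \ {f}) (hT k))
    · rw [coe_univ, Set.univ_subset_iff] at hT; subst hT; exact univ_mem_of_nonempty (hU j) (hne j)
  have hns : ∀ k, U k ≠ Set.univ := fun k hk => h0 k (hk ▸ Set.mem_univ _)
  -- at least two coordinates
  have hι : ∀ f : ι, ∃ h, h ≠ f := by
    intro f
    by_contra hsub
    push Not at hsub
    have hmem : ∀ j (ω : Set ι), ω ∈ U j ↔ f ∈ ω := by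
      intro j ω
      constructor
      · intro hω; by_contra hfω
        have : ω = ∅ := Set.eq_empty_of_forall_notMem fun x hx => hfω ((hsub x) ▸ hx)
        exact h0 j (this ▸ hω)
      · intro hfω
        have : ω = Set.univ := Set.eq_univ_of_forall fun x => (hsub x).symm ▸ hfω
        rw [this]; exact univ_mem_of_nonempty (hU j) (hne j)
    obtain ⟨l, -, hnot⟩ := habs 0
    exact hnot fun ω hω => (hmem 0 ω).2 ((hmem l ω).1 hω)
  -- faces structured
  have hS : ∀ h, Structured (faceT U h) univ := by
    intro h
    have hz : SuppZeroFlag ((n + 2) + 2) (fun j => faceT U h (id j)) := by exact hall h true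
    have := structured_of_suppZeroFlag (n + 2) (faceT U h) (isUpperSet_faceT U hU h) (faceT_nonempty U hU hne h) id injective_id hz
    convert this using 2; simp
  have hF : ∀ f, CoreFree U f → Structured (faceF U f) univ := by
    intro f hf
    have hz : SuppZeroFlag ((n + 2) + 2) (fun j => faceF U f (id j)) := by exact hall f false
    have := structured_of_suppZeroFlag (n + 2) (faceF U f) (isUpperSet_faceF U hU f) (faceF_nonempty U hf) id injective_id hz
    convert this using 2; simp
  have hd := gframe_disjoint_all n ι U hU hne h0 (fun e b => by exact hall e b) habs
  refine localToGlobal_all n ι U hU hne hns hS hd hF hE0 hι habs ?_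
  intro x hs
  apply hno x
  refine suppZeroFlag_of_structured (n + 1) U hU hne (fun j => x.succAbove j) Fin.succAbove_right_injective ?_
  convert hs using 2
  ext j
  simp [Fin.exists_succAbove_eq_iff]

/-- **(FVT_k) — face-vanishing families are principal-cap, every order `k ≥ 4`, no side conditions**: `n + 4` increasing, non-empty,
non-sure events determined by `S`, with no `Z_{n+3}` deletion, all minors at coordinates of `S` zero flags, and no member containing all the
others, have `⋂_j U_j = {T | ↑c ⊆ T}` for some `c`.  (Transport to `↥S` by `pull`, as in `terminalTightAt_of_pull`.) [this work] -/
theorem principalCap_of_faceVanishing (n : ℕ) (ι : Type) [Fintype ι] (U : Fin (n + 1 + 3) → Set (Set ι)) (S : Finset ι)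
    (hU : ∀ j, IsUpperSet (U j)) (hUS : ∀ j, DeterminedBy (U j) (↑S : Set ι)) (hne : ∀ j, (U j).Nonempty)
    (h0 : ∀ j, (∅ : Set ι) ∉ U j) (hno : ∀ m : Fin (n + 1 + 3), ¬ SuppZeroFlag (n + 1 + 2) (fun j => U (m.succAbove j)))
    (hall : ∀ e ∈ S, ∀ b : Bool, SuppZeroFlag (n + 1 + 3) (fun j => secAt e b (U j)))
    (habs : ∀ j, ∃ l, l ≠ j ∧ ¬ U l ⊆ U j) :
    ∃ c : Finset ι, ∀ T : Set ι, (∀ j, T ∈ U j) ↔ (↑c : Set ι) ⊆ T := by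
  have hU' : ∀ j, IsUpperSet (pull S (U j)) := fun j => isUpperSet_pull S (hU j)
  obtain ⟨c', hc'⟩ := principalCap_of_faceVanishing_univ n ↥S (fun j => pull S (U j)) hU'
    (fun j => pull_nonempty S (hUS j) (hne j)) (fun j => empty_not_mem_pull S (h0 j))
    (fun m hm => hno m (suppZeroFlag_of_pull S (n + 1 + 2) _ (fun j => hUS _) hm))
    (fun e b => by
      have := suppZeroFlag_pull S (n + 1 + 3) _ (hall (e : ι) e.2 b)
      convert this using 1
      funext j; exact (pull_secAt S (U j) e b).symm)
    (fun j => by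
      obtain ⟨l, hlj, hnot⟩ := habs j
      exact ⟨l, hlj, fun hsub => hnot (subset_of_pull_subset S (hUS l) (hUS j) hsub)⟩)
  exact ⟨c'.image Subtype.val, principalCap_of_pull S hUS hc'⟩

end GluedFrames

namespace Pointwise

open SahiComb

variable {ι : Type} [Fintype ι]

/-! ### 2. Order four -/

/-- The members of a family with no absorbing member and no zero-flag deletion are non-empty and non-sure. [this work] -/
theorem nonempty_and_nonsure_of_noAbsorber {n : ℕ} (U : Fin (n + 3) → Set (Set ι)) (hU : ∀ j, IsUpperSet (U j))
    (hno : ∀ m : Fin (n + 3), ¬ SuppZeroFlag (n + 2) (fun j => U (m.succAbove j)))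
    (habs : ∀ j, ∃ l, l ≠ j ∧ ¬ U l ⊆ U j) : (∀ j, (U j).Nonempty) ∧ ∀ j, (∅ : Set ι) ∉ U j := by
  refine ⟨fun j => ?_, fun j h => ?_⟩
  · by_contra h
    rw [Set.not_nonempty_iff_eq_empty] at h
    obtain ⟨l, hl, -⟩ := habs j
    obtain ⟨m, hm⟩ := Fin.exists_succAbove_eq hl.symm
    exact hno l (suppZeroFlag_of_mem_empty (n + 1) (fun i => U (l.succAbove i)) m (by rw [hm]; exact h))
  · obtain ⟨l, _, hlj⟩ := habs j
    exact hlj fun T _ => hU j (Set.empty_subset T) h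

/-- **The deleted family of an absorbing member of a face-vanishing family is face-vanishing** (order `n + 4 → n + 3`): its minors are the
deleted minors, whose `E_{n+3}` vanishes identically by the factorisation `E_{n+4} = ((n+3) − μ) · E_{n+3}` and which are therefore zero
flags by (EQI-(n+3)). [this work] -/
theorem faceVanishing_erase_of_absorbing {n : ℕ} (U : Fin (n + 4) → Set (Set ι)) (S : Finset ι) (hU : ∀ j, IsUpperSet (U j))
    (hall : ∀ e ∈ S, ∀ b : Bool, SuppZeroFlag (n + 4) (fun j => secAt e b (U j))) (j : Fin (n + 4))
    (hj : ∀ l, l ≠ j → U l ⊆ U j) :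
    ∀ e ∈ S, ∀ b : Bool, SuppZeroFlag (n + 3) (fun i => secAt e b (U (j.succAbove i))) := by
  intro e he b
  have hVu : ∀ i, IsUpperSet (secAt e b (U i)) := fun i => isUpperSet_secAt e b (hU i)
  have hVabs : ∀ l, l ≠ j → secAt e b (U l) ⊆ secAt e b (U j) :=
    fun l hl ω hω => mem_secAt.2 (hj l hl (mem_secAt.1 hω))
  refine (GluedFrames.masterFamilyIdentEqIff_all (n + 3) ι (fun i => secAt e b (U (j.succAbove i))) fun i => hVu _).1 fun q _ => ?_
  have hz : sahiE (bernoulliWeight q) (n + 4) (fun i => ind (secAt e b (U i))) = 0 := masterFamilyEqIff_mpr _ ι q _ (hall e he b)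
  rw [sahiE_ind_eq_of_absorbing (bernoulliWeight q) (n := n + 2) (fun i => secAt e b (U i)) j hVabs] at hz
  refine (mul_eq_zero.1 hz).resolve_left (ne_of_gt ?_)
  have h1 := ex_bernoulliWeight_ind_le_one q (secAt e b (U j))
  push_cast
  linarith

/-- With an absorbing member `U_j`: `U ∈ Z_{n+3} ↔ U_{−j} ∈ Z_{n+2}` (`⇐` by the definition of `Z` with the flag at `j`, `U_l ∩ U_j = U_l`;
`⇒` by the factorisation and (EQI)). [this work] -/
theorem suppZeroFlag_iff_erase_of_absorbing {n : ℕ} (U : Fin (n + 3) → Set (Set ι)) (hU : ∀ j, IsUpperSet (U j)) (j : Fin (n + 3))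
    (hj : ∀ l, l ≠ j → U l ⊆ U j) : SuppZeroFlag (n + 3) U ↔ SuppZeroFlag (n + 2) (fun i => U (j.succAbove i)) := by
  constructor
  · intro hZ
    refine (GluedFrames.masterFamilyIdentEqIff_all (n + 2) ι (fun i => U (j.succAbove i)) fun i => hU _).1 fun q _ => ?_
    have hz : sahiE (bernoulliWeight q) (n + 3) (fun i => ind (U i)) = 0 := masterFamilyEqIff_mpr _ ι q _ hZ
    rw [sahiE_ind_eq_of_absorbing (bernoulliWeight q) (n := n + 1) U j hj] at hz
    refine (mul_eq_zero.1 hz).resolve_left (ne_of_gt ?_)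
    have h1 := ex_bernoulliWeight_ind_le_one q (U j)
    push_cast
    linarith
  · intro hZ
    refine ⟨j, hZ, fun l => ?_⟩
    have hl : U (j.succAbove l) ∩ U j = U (j.succAbove l) := Set.inter_eq_left.2 (hj _ (Fin.succAbove_ne j l))
    rw [hl, update_eq_self]
    exact hZ

/-- **(M⁺-4) on face-vanishing quadruples without absorbing member and without `Z₃` deletion** (principal-cap by
`GluedFrames.principalCap_of_faceVanishing`, then `combPos_sahiE_four_of_principalCap`). [this work] -/
theorem combPos_sahiE_four_of_faceVanishing_noAbsorber (U : Fin 4 → Set (Set ι)) (S : Finset ι) (hU : ∀ j, IsUpperSet (U j))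
    (hUS : ∀ j, DeterminedBy (U j) (↑S : Set ι)) (hno : ∀ m : Fin 4, ¬ SuppZeroFlag 3 (fun j => U (m.succAbove j)))
    (hall : ∀ e ∈ S, ∀ b : Bool, SuppZeroFlag 4 (fun j => secAt e b (U j))) (habs : ∀ j, ∃ l, l ≠ j ∧ ¬ U l ⊆ U j) :
    CombPos (fun _ : ι => 4) (fun p => sahiE (bernoulliWeight p) 4 (fun j => ind (U j))) := by
  obtain ⟨hne, h0⟩ := nonempty_and_nonsure_of_noAbsorber U hU hno habs
  obtain ⟨c, hcap⟩ := GluedFrames.principalCap_of_faceVanishing 0 ι U S hU hUS hne h0 hno hall habs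
  exact combPos_sahiE_four_of_principalCap U hU c hcap

/-- **Pointwise (EQ-4) on EVERY face-vanishing quadruple**: four increasing events determined by `S`, all of whose minors at coordinates
of `S` are zero flags, satisfy `E₄(μ_p; 1_U) = 0 ↔ U ∈ Z₄` at every interior `p`. [this work] -/
theorem sahiE_four_ind_eq_zero_iff_of_faceVanishing (p : ι → unitInterval) (hp : ∀ e, (p e : ℝ) ∈ Set.Ioo (0 : ℝ) 1)
    (U : Fin 4 → Set (Set ι)) (S : Finset ι) (hU : ∀ j, IsUpperSet (U j)) (hUS : ∀ j, DeterminedBy (U j) (↑S : Set ι))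
    (hall : ∀ e ∈ S, ∀ b : Bool, SuppZeroFlag 4 (fun j => secAt e b (U j))) :
    sahiE (bernoulliWeight p) 4 (fun j => ind (U j)) = 0 ↔ SuppZeroFlag 4 U := by
  refine ⟨fun hz => ?_, fun hZ => masterFamilyEqIff_mpr 4 ι p U hZ⟩
  by_cases habs : ∃ j, ∀ l, l ≠ j → U l ⊆ U j
  · -- an absorbing member factors off
    obtain ⟨j, hj⟩ := habs
    rw [sahiE_ind_eq_of_absorbing (bernoulliWeight p) (n := 2) U j hj] at hz
    have hfac : (0 : ℝ) < ((2 : ℕ) : ℝ) + 1 - ex (bernoulliWeight p) (ind (U j)) := by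
      have h1 := ex_bernoulliWeight_ind_le_one p (U j)
      push_cast
      linarith
    have hE3 : sahiE (bernoulliWeight p) 3 (fun i => ind (U (j.succAbove i))) = 0 := (mul_eq_zero.1 hz).resolve_left hfac.ne'
    have hZ3 : SuppZeroFlag 3 (fun i => U (j.succAbove i)) :=
      (sahiE_three_ind_eq_zero_iff_of_faceVanishing ι p hp (fun i => U (j.succAbove i)) S (fun i => hU _) (fun i => hUS _)
        (faceVanishing_erase_of_absorbing U S hU hall j hj)).1 hE3
    exact (suppZeroFlag_iff_erase_of_absorbing U hU j hj).2 hZ3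
  · push Not at habs
    by_cases hdel : ∃ m : Fin 4, SuppZeroFlag 3 (fun j => U (m.succAbove j))
    · obtain ⟨m, hm⟩ := hdel
      exact ((masterFamily_step_all p U hU m hm).2 hp).1 hz
    · push Not at hdel
      exact (sahiE_ind_eq_zero_iff_of_combPos hU (combPos_sahiE_four_of_faceVanishing_noAbsorber U S hU hUS hdel hall habs) hp).1 hz

/-- **Sahi's `C₄` on EVERY face-vanishing quadruple**, every `p ∈ [0,1]^ι`. [this work] -/
theorem sahiE_four_ind_nonneg_of_faceVanishing (p : ι → unitInterval) (U : Fin 4 → Set (Set ι)) (S : Finset ι)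
    (hU : ∀ j, IsUpperSet (U j)) (hUS : ∀ j, DeterminedBy (U j) (↑S : Set ι))
    (hall : ∀ e ∈ S, ∀ b : Bool, SuppZeroFlag 4 (fun j => secAt e b (U j))) :
    0 ≤ sahiE (bernoulliWeight p) 4 (fun j => ind (U j)) := by
  by_cases habs : ∃ j, ∀ l, l ≠ j → U l ⊆ U j
  · obtain ⟨j, hj⟩ := habs
    rw [sahiE_ind_eq_of_absorbing (bernoulliWeight p) (n := 2) U j hj]
    refine mul_nonneg ?_ (sahiE_three_nonneg_of_faceVanishing ι p (fun i => U (j.succAbove i)) S (fun i => hU _) (fun i => hUS _)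
      (faceVanishing_erase_of_absorbing U S hU hall j hj))
    have h1 := ex_bernoulliWeight_ind_le_one p (U j)
    push_cast
    linarith
  · push Not at habs
    by_cases hdel : ∃ m : Fin 4, SuppZeroFlag 3 (fun j => U (m.succAbove j))
    · obtain ⟨m, hm⟩ := hdel
      exact (masterFamily_step_all p U hU m hm).1
    · push Not at hdel
      exact (combPos_sahiE_four_of_faceVanishing_noAbsorber U S hU hUS hdel hall habs).nonneg p

/-- Strict form: a face-vanishing quadruple outside `Z₄` has `E₄(μ_p) > 0` at every interior `p`. [this work] -/
theorem sahiE_four_ind_pos_of_faceVanishing (p : ι → unitInterval) (hp : ∀ e, (p e : ℝ) ∈ Set.Ioo (0 : ℝ) 1)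
    (U : Fin 4 → Set (Set ι)) (S : Finset ι) (hU : ∀ j, IsUpperSet (U j)) (hUS : ∀ j, DeterminedBy (U j) (↑S : Set ι))
    (hall : ∀ e ∈ S, ∀ b : Bool, SuppZeroFlag 4 (fun j => secAt e b (U j))) (hZ : ¬ SuppZeroFlag 4 U) :
    0 < sahiE (bernoulliWeight p) 4 (fun j => ind (U j)) :=
  lt_of_le_of_ne (sahiE_four_ind_nonneg_of_faceVanishing p U S hU hUS hall) fun h =>
    hZ ((sahiE_four_ind_eq_zero_iff_of_faceVanishing p hp U S hU hUS hall).1 h.symm)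

/-! ### 3. Order five, law level -/

/-- **Sahi's `C₅` on EVERY face-vanishing 5-family**, every `p ∈ [0,1]^ι`: absorbing member ⟹ `E₅ = (4 − μ)·E₄(U_{−j})` with a
face-vanishing quadruple; a `Z₄` deletion ⟹ the all-order step; else principal-cap (`GluedFrames.principalCap_of_faceVanishing 1`) and seat
P4's `PrincipalCapC3.sahiE_five_ind_nonneg_of_principalCap`. [this work] -/
theorem sahiE_five_ind_nonneg_of_faceVanishing (p : ι → unitInterval) (U : Fin 5 → Set (Set ι)) (S : Finset ι)
    (hU : ∀ j, IsUpperSet (U j)) (hUS : ∀ j, DeterminedBy (U j) (↑S : Set ι))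
    (hall : ∀ e ∈ S, ∀ b : Bool, SuppZeroFlag 5 (fun j => secAt e b (U j))) :
    0 ≤ sahiE (bernoulliWeight p) 5 (fun j => ind (U j)) := by
  by_cases habs : ∃ j, ∀ l, l ≠ j → U l ⊆ U j
  · obtain ⟨j, hj⟩ := habs
    rw [sahiE_ind_eq_of_absorbing (bernoulliWeight p) (n := 3) U j hj]
    refine mul_nonneg ?_ (sahiE_four_ind_nonneg_of_faceVanishing p (fun i => U (j.succAbove i)) S (fun i => hU _) (fun i => hUS _)
      (faceVanishing_erase_of_absorbing U S hU hall j hj))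
    have h1 := ex_bernoulliWeight_ind_le_one p (U j)
    push_cast
    linarith
  · push Not at habs
    by_cases hempty : ∃ j, U j = ∅
    · obtain ⟨j, hj⟩ := hempty
      exact (sahiE_ind_eq_zero_of_eq_empty p U j hj).ge
    · by_cases hdel : ∃ m : Fin 5, SuppZeroFlag 4 (fun j => U (m.succAbove j))
      · obtain ⟨m, hm⟩ := hdel
        exact (masterFamily_step_all p U hU m hm).1
      · push Not at hdel
        obtain ⟨hne, h0⟩ := nonempty_and_nonsure_of_noAbsorber U hU hdel habs
        obtain ⟨c, hcap⟩ := GluedFrames.principalCap_of_faceVanishing 1 ι U S hU hUS hne h0 hdel hall habs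
        exact PrincipalCapC3.sahiE_five_ind_nonneg_of_principalCap p U hU c hcap

end Pointwise

end Summit.CriticalPhenomena.PercolationContinuityZ3.Theorems
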